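import Literature.NumberTheory.Rogawski1990.PreStabilisationSingularSelfOfLocalAdelic
import Literature.NumberTheory.Rogawski1990.MatchingAdeleGKConjSemisimple
import Literature.NumberTheory.Automorphic.UnramifiedOrbitalUnitFactorSemisimple
import Literature.NumberTheory.Automorphic.UnitaryGroupOrbitalIntegrandIntegrable
import Literature.NumberTheory.Automorphic.UnramifiedOrbitalEulerOfAdmissible
import Literature.NumberTheory.Rogawski1990.AdelicNormalisationSemisimple
import Literature.NumberTheory.Rogawski1990.SingularObsHasseRealisation
import HarnessLib

/-!
# The rational-class geometric term READ on the self carrier AT A SPLIT SEMISIMPLE CLASS: `Φ^st_{ofLocal}(𝒪_st(γ₀), T.eval) = Σ_{[γ] ⊂ 𝒪_st(γ₀)} Φ_{ofLocalAdelic}([γ ⊗ 1], T.eval)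
# = ½ · (Φ^{st,𝐀}_{G′}(γ₀) + Φ^{κ,𝐀}_{G′}(γ₀))` — the regularity-free twin of ★ (e) `StableClassOrbitalSumToAdelic` and the `J`-side input `hD1` of the T1b identity at a
# singular class (Rogawski 1990, §5.4 (5.4.1)–(5.4.3) pp. 72–73; §14.5 pp. 238–239; Kottwitz 1986 Cor. 7.3, §9)

Topic `NumberTheory/Rogawski1990`; namespace `Literature.NumberTheory.Rogawski1990`; **THEOREMS ONLY** (no definition, no named fact, no instance, no
notation, no `sorry`).  Cell `pub/hodgecm-mathlib`, ENGINE T1 (crux H413 = `stmt-HodgeConjecture-24833`), row O7 «singular semisimple classes», piece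
**(D1-s) FILE 4** (O7 OWNER WORD #16): (e)-s, the per-class bridge between the kit's `J`-side currency (★ C2 `AdelicOrbitalMeasureFamily.ofLocal mG mGi` on the
RATIONAL classes) and the count's currency (★ C3 `OrbitalMeasureFamily.ofLocalAdelic mG mGi` on the ADELIC classes) at the rational classes of a SPLIT SEMISIMPLE
stable class `𝒪_st(γ₀)` (`(γ₀ − a)(γ₀ − b) = 0`, `a ≠ b`) of the ANISOTROPIC `U(H)` — the proof of ★ (e) with «regular ⇒ canonical normalisation ∕ (K-J) Euler
product» replaced by «semisimple ⇒ (KC) a.e. (★ K6-α `eventually_forall_integralConj_cmDatum_of_isStablyConj`) ⇒ ★ K6-β-s Euler product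
`adelicClassOrbitalIntegral_ofLocal_eval_eq_mul_prod_of_isTest` + unit factors `exists_finset_forall_classOrbitalIntegral_loc_eq_one_of_integralConj`», normalisation
taken as the binder `hnorm` at every matching adèle (O10-s ∕ `IsNormalisedOff` by level), admissibility class-local at the classes corresponding to `(γ₀)_v` ∕
`γ₀ ⊗ 1`, integrability by ★ ζ1″; then summed over `𝒪_st(γ₀)` and composed with ★ (D1-s) FILE 3 — the binder `hD1` of the line's T1b-SING closer
`lawT1b_singular_of_pieces` (A-p16 (g20) skeleton v2), `r`-free and in its `(1 ∕ 2 : ℂ)` spelling.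

* §1 **`classOrbitalIntegral_ofLocalAdelic_map_toAdelic_eq_adelicClassOrbitalIntegral_ofLocal_of_mul_sub_eq_zero`** — per class `c ⊂ 𝒪_st(γ₀)`:
  `classOrbitalIntegral (ofLocalAdelic mG mGi) T.eval (ConjClasses.map toAdelic c) = adelicClassOrbitalIntegral (ofLocal mG mGi) T.eval c`.
* §2 **`stableOrbitalSum_ofLocalAdelic_map_toAdelic_eq_adelicStableOrbitalIntegral_ofLocal_of_mul_sub_eq_zero`** — summed over `𝒪_st(γ₀)`.
* §3 **`adelicStableOrbitalIntegral_ofLocal_stableClassOf_eq_half_of_singularObs`** — `hD1`: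
  `Φ^st_{ofLocal mG mGi}(𝒪_st(γ₀), T.eval) = (1∕2) · (adelicStableOrbitalSum 𝒞′_𝐀(γ₀) (ofLocalAdelic mG mGi) T.eval + adelicKappaOrbitalSum 𝒞′_𝐀(γ₀) W (ofLocalAdelic mG mGi) T.eval)`;
  **`…_eq_mul_half_of_singularObs`** — the β-socket edition `Φ^st_{μA}(𝒪_st(γ₀), T.eval) = r · (1∕2) · (…)` under `μA c = ENNReal.ofReal r • ofLocal mG mGi c` on `𝒪_st(γ₀)`.

HONEST LABEL: nothing printed is consumed; `hHasse` (singular ObsHasse, ★ `SingularObsHasse` assembling) and the κ-weight `W` (pin `PinSingularKappaHalf`) stay binders;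
HC_CM is proved only modulo the printed citations until rung 0 closes.

## References
* [Rogawski1990] J. D. Rogawski, *Automorphic Representations of Unitary Groups in Three Variables*, Ann. of Math. Stud. 123 (1990), §3.3 p. 21, §3.8 Prop. 3.8.1
  p. 27, §4.3 p. 44, §5.4 (5.4.1)–(5.4.3) pp. 72–73, §14.5 pp. 238–239.
* [Kottwitz1986] R. E. Kottwitz, *Stable trace formula: elliptic singular terms*, Math. Ann. 275 (1986), Prop. 7.1, Cor. 7.3, §9.
* [Gelbart1975] S. Gelbart, *Automorphic Forms on Adele Groups*, Ann. of Math. Stud. 83 (1975), p. 155 (10.19).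
-/

set_option autoImplicit false

noncomputable section

open NumberField IsDedekindDomain Filter Function MeasureTheory
open scoped Matrix MatrixGroups ENNReal

namespace Literature.NumberTheory.Rogawski1990

open Literature.NumberTheory.Automorphic Literature.LinearAlgebra.Matrix Literature.MeasureTheory.Group
open Literature.AlgebraicGeometry.ShimuraVarieties (unitaryGroup hermForm)

section Bridge

variable {L : Type} [Field L] [NumberField L] [IsCMField L] {H : Matrix (Fin 3) (Fin 3) L} {γ₀ : (UnitaryGroup.cmDatum L 3 H).Rational} {a b : L}
  [∀ g : (UnitaryGroup.cmDatum L 3 H).Adelic,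
    MeasurableSpace ((UnitaryGroup.cmDatum L 3 H).Adelic ⧸ Subgroup.centralizer ({g} : Set (UnitaryGroup.cmDatum L 3 H).Adelic))]
  [∀ g : (UnitaryGroup.cmDatum L 3 H).Adelic,
    BorelSpace ((UnitaryGroup.cmDatum L 3 H).Adelic ⧸ Subgroup.centralizer ({g} : Set (UnitaryGroup.cmDatum L 3 H).Adelic))]
  [∀ (v : HeightOneSpectrum (𝓞 ↥(maximalRealSubfield L))) (x : (UnitaryGroup.cmDatum L 3 H).Local v),
    MeasurableSpace ((UnitaryGroup.cmDatum L 3 H).Local v ⧸ Subgroup.centralizer ({x} : Set ((UnitaryGroup.cmDatum L 3 H).Local v)))]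
  [∀ (v : HeightOneSpectrum (𝓞 ↥(maximalRealSubfield L))) (x : (UnitaryGroup.cmDatum L 3 H).Local v),
    BorelSpace ((UnitaryGroup.cmDatum L 3 H).Local v ⧸ Subgroup.centralizer ({x} : Set ((UnitaryGroup.cmDatum L 3 H).Local v)))]
  [∀ a : UnitaryGroup.arch (↥(maximalRealSubfield L)) L (IsCMField.complexConj L) 3 H,
    MeasurableSpace (UnitaryGroup.arch (↥(maximalRealSubfield L)) L (IsCMField.complexConj L) 3 H ⧸
      Subgroup.centralizer ({a} : Set (UnitaryGroup.arch (↥(maximalRealSubfield L)) L (IsCMField.complexConj L) 3 H)))]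
  [∀ a : UnitaryGroup.arch (↥(maximalRealSubfield L)) L (IsCMField.complexConj L) 3 H,
    BorelSpace (UnitaryGroup.arch (↥(maximalRealSubfield L)) L (IsCMField.complexConj L) 3 H ⧸
      Subgroup.centralizer ({a} : Set (UnitaryGroup.arch (↥(maximalRealSubfield L)) L (IsCMField.complexConj L) 3 H)))]

/-! ## §1 Per class: `Φ_{ofLocalAdelic}([toAdelic (out c)], T.eval) = Φ_{ofLocal}(c, T.eval)` at the classes of a split semisimple stable class -/

/-- **PER CLASS — the two currencies give the same orbital integral at a SPLIT SEMISIMPLE stable class** (`H` anisotropic hermitian, `(γ₀ − a)(γ₀ − b) = 0`,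
`a ≠ b`, `c ⊂ 𝒪_st(γ₀)` a rational class): `classOrbitalIntegral (ofLocalAdelic mG mGi) T.eval (ConjClasses.map toAdelic c) = adelicClassOrbitalIntegral (ofLocal mG mGi) T.eval c`
for local families `mG v`, `mGi` admissible on the classes corresponding to `(γ₀)_v` ∕ `γ₀ ⊗ 1`, `mG` normalised off a finite set at every matching adèle, and an
`IsTest` pure tensor `T` — both sides are `Φ_{mGi}([γ_∞], T.arch) · ∏_{v ∈ S₂} Φ_{mG v}([γ_v], T.loc v)`, `γ = toAdelic (out c)`: on the right ★ K6-β-s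
`adelicClassOrbitalIntegral_ofLocal_eval_eq_mul_prod_of_isTest` with the unit factors of ★ `exists_finset_forall_classOrbitalIntegral_loc_eq_one_of_integralConj` at the
clause (KC) of ★ K6-α `eventually_forall_integralConj_cmDatum_of_isStablyConj` (`out c ∼_st γ₀`, `γ₀` semisimple); on the left ★ C3
`classOrbitalIntegral_ofLocalAdelic_eval_eq_mul_prod` at `[γ]` (same local classes, ★ `conjClassesMk_toLocal_out_eq`), its integrability by ★ ζ1″
`MatchingAdeleG₂.integrable_descConj_ofLocalAdelic_of_mem_classes_of_eventuallyKConj`.  Regularity-free twin of ★ (e)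
`classOrbitalIntegral_ofLocalAdelic_map_toAdelic_eq_adelicClassOrbitalIntegral_ofLocal`. [cite: Rogawski1990, §5.4 p. 72; §3.8 Prop. 3.8.1 p. 27]
[cite: Gelbart1975, p. 155 (10.19)] [cite: Kottwitz1986, Prop. 7.1, Cor. 7.3] -/
theorem classOrbitalIntegral_ofLocalAdelic_map_toAdelic_eq_adelicClassOrbitalIntegral_ofLocal_of_mul_sub_eq_zero
    (hH : (H.map (cmConjRingHom L))ᵀ = H) (hanis : ∀ x : Fin 3 → L, hermForm (cmConjRingHom L) H x x = 0 → x = 0)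
    (hab : a ≠ b)
    (hγ₀ : ((((γ₀ : unitaryGroup (cmConjRingHom L) H).val : GL (Fin 3) L) : Matrix (Fin 3) (Fin 3) L) - a • (1 : Matrix (Fin 3) (Fin 3) L)) *
      ((((γ₀ : unitaryGroup (cmConjRingHom L) H).val : GL (Fin 3) L) : Matrix (Fin 3) (Fin 3) L) - b • (1 : Matrix (Fin 3) (Fin 3) L)) = 0)
    (mG : ∀ v : HeightOneSpectrum (𝓞 ↥(maximalRealSubfield L)), OrbitalMeasureFamily ((UnitaryGroup.cmDatum L 3 H).Local v))
    (mGi : OrbitalMeasureFamily (UnitaryGroup.arch (↥(maximalRealSubfield L)) L (IsCMField.complexConj L) 3 H))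
    (hadm : ∀ v, (mG v).IsAdmissibleOn fun x : (UnitaryGroup.cmDatum L 3 H).Local v =>
      Corresponds (UnitaryGroup.conjLocal L (IsCMField.complexConj L) v)
        ((UnitaryGroup.adelicForm L 3 H).map (UnitaryGroup.adeleToLocal L v))
        ((UnitaryGroup.adelicForm L 3 H).map (UnitaryGroup.adeleToLocal L v))
        ((UnitaryGroup.cmDatum L 3 H).toLocal v ((UnitaryGroup.cmDatum L 3 H).toAdelic γ₀)) x)
    (hadmA : mGi.IsAdmissibleOn fun a : UnitaryGroup.arch (↥(maximalRealSubfield L)) L (IsCMField.complexConj L) 3 H =>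
      Corresponds (UnitaryGroup.conjMixed (↥(maximalRealSubfield L)) L (IsCMField.complexConj L)) (UnitaryGroup.archFormOf L 3 H)
        (UnitaryGroup.archFormOf L 3 H) (cmRationalToArch L 3 H γ₀) a)
    (hnorm : ∀ p : MatchingAdeleG₂ L H H γ₀, ∃ S₀ : Finset (HeightOneSpectrum (𝓞 ↥(maximalRealSubfield L))),
      UnitaryGroup.IsNormalisedOff L 3 H mG p.adele S₀)
    (T : UnitaryGroup.PureTensor L 3 H) (hT : T.IsTest)
    {c : ConjClasses (UnitaryGroup.cmDatum L 3 H).Rational} (hc : c ∈ conjClassesIn (cmConjRingHom L) H γ₀) :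
    classOrbitalIntegral (UnitaryGroup.OrbitalMeasureFamily.ofLocalAdelic L 3 H mG mGi) T.eval (ConjClasses.map (UnitaryGroup.cmDatum L 3 H).toAdelic c) =
      UnitaryGroup.adelicClassOrbitalIntegral L 3 H (UnitaryGroup.AdelicOrbitalMeasureFamily.ofLocal L 3 H mG mGi) T.eval c := by
  classical
  have hdet : H.det ≠ 0 := Godement.det_ne_zero_of_anisotropic L H hanis
  have hss : IsSemisimpleElt (cmConjRingHom L) H γ₀ := isSemisimple_toLin'_of_mul_sub_eq_zero hab hγ₀
  -- admissibility triples at a local ∕ archimedean point corresponding to `(γ₀)_v` ∕ `γ₀ ⊗ 1`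
  have hadmAt : ∀ v (x : (UnitaryGroup.cmDatum L 3 H).Local v),
      Corresponds (UnitaryGroup.conjLocal L (IsCMField.complexConj L) v)
        ((UnitaryGroup.adelicForm L 3 H).map (UnitaryGroup.adeleToLocal L v))
        ((UnitaryGroup.adelicForm L 3 H).map (UnitaryGroup.adeleToLocal L v))
        ((UnitaryGroup.cmDatum L 3 H).toLocal v ((UnitaryGroup.cmDatum L 3 H).toAdelic γ₀)) x →
      mG v (ConjClasses.mk x) ≠ 0 ∧ SMulInvariantMeasure _ _ (mG v (ConjClasses.mk x)) ∧ IsFiniteMeasureOnCompacts (mG v (ConjClasses.mk x)) :=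
    fun v x hx => hadm v (ConjClasses.mk x) (hx.of_isStablyConj_right (isStablyConj_of_isConj (isConj_out_conjClasses_mk x)))
  -- (0) the representative `δ := out c` is stably conjugate to `γ₀`; its diagonal adèle is a matching adèle
  have hmk : ConjClasses.mk (Quotient.out c) = c := by
    rw [← ConjClasses.quotient_mk_eq_mk]
    exact Quotient.out_eq c
  have hst : IsStablyConj (cmConjRingHom L) H γ₀ (Quotient.out c) := by
    have hc' := hc
    rw [← hmk] at hc'
    exact mk_mem_conjClassesIn_iff.1 hc'
  let q : MatchingAdeleG₂ L H H γ₀ := MatchingAdeleG₂.ofIsStablyConjSelf hst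
  have hq : q.adele = (UnitaryGroup.cmDatum L 3 H).toAdelic (Quotient.out c) := MatchingAdeleG₂.adele_ofIsStablyConjSelf hst
  -- (1) normalisation and point admissibility at `toAdelic (out c)`
  obtain ⟨S₀, hS₀⟩ := hnorm q
  rw [hq] at hS₀
  have hadmP : ∀ v, mG v (ConjClasses.mk ((UnitaryGroup.cmDatum L 3 H).toLocal v ((UnitaryGroup.cmDatum L 3 H).toAdelic (Quotient.out c)))) ≠ 0 ∧
      SMulInvariantMeasure ((UnitaryGroup.cmDatum L 3 H).Local v) _
        (mG v (ConjClasses.mk ((UnitaryGroup.cmDatum L 3 H).toLocal v ((UnitaryGroup.cmDatum L 3 H).toAdelic (Quotient.out c))))) ∧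
      IsFiniteMeasureOnCompacts (mG v (ConjClasses.mk ((UnitaryGroup.cmDatum L 3 H).toLocal v ((UnitaryGroup.cmDatum L 3 H).toAdelic (Quotient.out c))))) :=
    fun v => hadmAt v _ (by have h := q.corresponds_toLocal v; rw [hq] at h; exact h)
  have hcorrA : Corresponds (UnitaryGroup.conjMixed (↥(maximalRealSubfield L)) L (IsCMField.complexConj L)) (UnitaryGroup.archFormOf L 3 H)
      (UnitaryGroup.archFormOf L 3 H) (cmRationalToArch L 3 H γ₀)
      (UnitaryGroup.archPart (↥(maximalRealSubfield L)) L (IsCMField.complexConj L) 3 H ((UnitaryGroup.cmDatum L 3 H).toAdelic (Quotient.out c))) := by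
    have h : Corresponds (UnitaryGroup.conjMixed (↥(maximalRealSubfield L)) L (IsCMField.complexConj L)) (UnitaryGroup.archFormOf L 3 H)
        (UnitaryGroup.archFormOf L 3 H) (cmRationalToArch L 3 H γ₀)
        (UnitaryGroup.archPart (↥(maximalRealSubfield L)) L (IsCMField.complexConj L) 3 H q.adele) := q.corresponds_arch
    rw [hq] at h
    exact h
  have hadmAP := hadmA _ (hcorrA.of_isStablyConj_right (isStablyConj_of_isConj (isConj_out_conjClasses_mk _)))
  -- (2) (KC) at `out c` (★ K6-α), the unit factors off a finite `S₂ ⊇ T.S` (★ K6-β-s) and the J-side Euler product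
  have hKc := eventually_forall_integralConj_cmDatum_of_isStablyConj hH hdet hss hst
  obtain ⟨S₂, -, hf1⟩ := UnitaryGroup.exists_finset_forall_classOrbitalIntegral_loc_eq_one_of_integralConj L 3 H mG (Quotient.out c) hKc
    (fun v => (hadmP v).2.1) hS₀ T hT.isUnramified
  have hJ := UnitaryGroup.adelicClassOrbitalIntegral_ofLocal_eval_eq_mul_prod_of_isTest L 3 H mG mGi c hanis hS₀ hadmP hadmAP T hT S₂ hf1
  -- (3) the adelic class of `toAdelic (out c)` is a class of the self carrier; its chosen representative is a matching adèle
  rw [conjClasses_map_toAdelic_eq_mk_out]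
  have hδmem : ConjClasses.mk ((UnitaryGroup.cmDatum L 3 H).toAdelic (Quotient.out c)) ∈ MatchingAdeleG₂.classes L H H γ₀ := by
    rw [← conjClasses_map_toAdelic_eq_mk_out]
    exact MatchingAdeleG₂.map_toAdelic_mem_classes γ₀ hc
  obtain ⟨q', hq'⟩ := MatchingAdeleG₂.exists_adele_eq_out_of_mem_classes hδmem
  obtain ⟨S₀', hS₀'⟩ := hnorm q'
  rw [hq'] at hS₀'
  have hadm' := fun v => hadmAt v ((UnitaryGroup.cmDatum L 3 H).toLocal v
      (Quotient.out (ConjClasses.mk ((UnitaryGroup.cmDatum L 3 H).toAdelic (Quotient.out c))) : (UnitaryGroup.cmDatum L 3 H).Adelic))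
    (by have h := q'.corresponds_toLocal v; rw [hq'] at h; exact h)
  have hcorrA' : Corresponds (UnitaryGroup.conjMixed (↥(maximalRealSubfield L)) L (IsCMField.complexConj L)) (UnitaryGroup.archFormOf L 3 H)
      (UnitaryGroup.archFormOf L 3 H) (cmRationalToArch L 3 H γ₀)
      (UnitaryGroup.archPart (↥(maximalRealSubfield L)) L (IsCMField.complexConj L) 3 H
        (Quotient.out (ConjClasses.mk ((UnitaryGroup.cmDatum L 3 H).toAdelic (Quotient.out c))) : (UnitaryGroup.cmDatum L 3 H).Adelic)) := by
    have h : Corresponds (UnitaryGroup.conjMixed (↥(maximalRealSubfield L)) L (IsCMField.complexConj L)) (UnitaryGroup.archFormOf L 3 H)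
        (UnitaryGroup.archFormOf L 3 H) (cmRationalToArch L 3 H γ₀)
        (UnitaryGroup.archPart (↥(maximalRealSubfield L)) L (IsCMField.complexConj L) 3 H q'.adele) := q'.corresponds_arch
    rw [hq'] at h
    exact h
  have hadmA' := hadmA _ (hcorrA'.of_isStablyConj_right (isStablyConj_of_isConj (isConj_out_conjClasses_mk _)))
  -- (4) integrability of the orbital integrand at the class (★ ζ1″ at `H₁ = H₂ = H`, `γ := γ₀`)
  have hγ₀' := mul_sub_smul_mul_sub_smul_eq_zero_of_isConj (IsConj.refl ((γ₀ : unitaryGroup (cmConjRingHom L) H).val : GL (Fin 3) L)) hγ₀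
  have hFi' := MatchingAdeleG₂.integrable_descConj_ofLocalAdelic_of_mem_classes_of_eventuallyKConj hH hdet (γ := γ₀) (IsConj.refl _)
    (MatchingAdeleG₂.eventuallyKConj_rel_of_isSemisimpleElt hH hdet (γ := γ₀) (IsConj.refl _) hss)
    (fun v => UnitaryGroup.isClosed_conjClass_localGL_of_mul_sub_eq_zero 3 v _ (isUnit_algebraMap_localRing_sub v hab)
      (mul_sub_smul_toLocal_toAdelic_eq_zero v γ₀ hγ₀'))
    (UnitaryGroup.isClosed_conjClass_mixedSpaceGL_of_mul_sub_eq_zero L 3 _ (isUnit_mixedEmbedding_sub hab)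
      (mul_sub_smul_cmRationalToArch_eq_zero γ₀ hγ₀'))
    mG mGi hadm hadmA hnorm T hT _ hδmem
  -- (5) the unit clause at the representative's local classes (= those of `toAdelic (out c)`)
  have hf1' : ∀ v, v ∉ S₂ → classOrbitalIntegral (mG v) (T.loc v) (ConjClasses.mk ((UnitaryGroup.cmDatum L 3 H).toLocal v
      (Quotient.out (ConjClasses.mk ((UnitaryGroup.cmDatum L 3 H).toAdelic (Quotient.out c))) : (UnitaryGroup.cmDatum L 3 H).Adelic))) = 1 := by
    intro v hv
    rw [UnitaryGroup.conjClassesMk_toLocal_out_eq L 3 H]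
    exact hf1 v hv
  -- (6) the adelic-side Euler product and the comparison
  rw [UnitaryGroup.classOrbitalIntegral_ofLocalAdelic_eval_eq_mul_prod L 3 H mG mGi _ hS₀' hadm' hadmA' T S₂ hT.isUnramified hFi' hf1', hJ,
    UnitaryGroup.conjClassesMk_archPart_out_eq L 3 H]
  exact congrArg _ (Finset.prod_congr rfl fun v _ => by rw [UnitaryGroup.conjClassesMk_toLocal_out_eq L 3 H])

/-! ## §2 Summed over the stable class -/

/-- **`Σ_{[γ] ⊂ 𝒪_st(γ₀)} Φ_{ofLocalAdelic}([toAdelic γ], T.eval) = Φ^st_{ofLocal}(𝒪_st(γ₀), T.eval)` AT A SPLIT SEMISIMPLE CLASS** — §1 class by class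
(`finsum_mem_congr`); regularity-free twin of ★ (e) `stableOrbitalSum_ofLocalAdelic_map_toAdelic_eq_adelicStableOrbitalIntegral_ofLocal`.
[cite: Rogawski1990, §5.4 (5.4.1) p. 72; §14.5 pp. 238–239] -/
theorem stableOrbitalSum_ofLocalAdelic_map_toAdelic_eq_adelicStableOrbitalIntegral_ofLocal_of_mul_sub_eq_zero
    (hH : (H.map (cmConjRingHom L))ᵀ = H) (hanis : ∀ x : Fin 3 → L, hermForm (cmConjRingHom L) H x x = 0 → x = 0)
    (hab : a ≠ b)
    (hγ₀ : ((((γ₀ : unitaryGroup (cmConjRingHom L) H).val : GL (Fin 3) L) : Matrix (Fin 3) (Fin 3) L) - a • (1 : Matrix (Fin 3) (Fin 3) L)) *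
      ((((γ₀ : unitaryGroup (cmConjRingHom L) H).val : GL (Fin 3) L) : Matrix (Fin 3) (Fin 3) L) - b • (1 : Matrix (Fin 3) (Fin 3) L)) = 0)
    (mG : ∀ v : HeightOneSpectrum (𝓞 ↥(maximalRealSubfield L)), OrbitalMeasureFamily ((UnitaryGroup.cmDatum L 3 H).Local v))
    (mGi : OrbitalMeasureFamily (UnitaryGroup.arch (↥(maximalRealSubfield L)) L (IsCMField.complexConj L) 3 H))
    (hadm : ∀ v, (mG v).IsAdmissibleOn fun x : (UnitaryGroup.cmDatum L 3 H).Local v =>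
      Corresponds (UnitaryGroup.conjLocal L (IsCMField.complexConj L) v)
        ((UnitaryGroup.adelicForm L 3 H).map (UnitaryGroup.adeleToLocal L v))
        ((UnitaryGroup.adelicForm L 3 H).map (UnitaryGroup.adeleToLocal L v))
        ((UnitaryGroup.cmDatum L 3 H).toLocal v ((UnitaryGroup.cmDatum L 3 H).toAdelic γ₀)) x)
    (hadmA : mGi.IsAdmissibleOn fun a : UnitaryGroup.arch (↥(maximalRealSubfield L)) L (IsCMField.complexConj L) 3 H =>
      Corresponds (UnitaryGroup.conjMixed (↥(maximalRealSubfield L)) L (IsCMField.complexConj L)) (UnitaryGroup.archFormOf L 3 H)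
        (UnitaryGroup.archFormOf L 3 H) (cmRationalToArch L 3 H γ₀) a)
    (hnorm : ∀ p : MatchingAdeleG₂ L H H γ₀, ∃ S₀ : Finset (HeightOneSpectrum (𝓞 ↥(maximalRealSubfield L))),
      UnitaryGroup.IsNormalisedOff L 3 H mG p.adele S₀)
    (T : UnitaryGroup.PureTensor L 3 H) (hT : T.IsTest) :
    stableOrbitalSum (cmConjRingHom L) H (fun c => classOrbitalIntegral (UnitaryGroup.OrbitalMeasureFamily.ofLocalAdelic L 3 H mG mGi) T.eval
        (ConjClasses.map (UnitaryGroup.cmDatum L 3 H).toAdelic c)) γ₀ =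
      UnitaryGroup.adelicStableOrbitalIntegral L 3 H (UnitaryGroup.AdelicOrbitalMeasureFamily.ofLocal L 3 H mG mGi) T.eval (stableClassOf (cmConjRingHom L) H γ₀) := by
  rw [UnitaryGroup.adelicStableOrbitalIntegral_stableClassOf, stableOrbitalSum, stableOrbitalSum]
  exact finsum_mem_congr rfl fun c hc =>
    classOrbitalIntegral_ofLocalAdelic_map_toAdelic_eq_adelicClassOrbitalIntegral_ofLocal_of_mul_sub_eq_zero hH hanis hab hγ₀ mG mGi hadm hadmA hnorm T hT hc

/-! ## §3 The `J`-side input of T1b at a singular class: `hD1` -/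

/-- **`hD1` — THE `J`-SIDE PRE-STABILISATION AT A SPLIT SEMISIMPLE CLASS IN THE KIT'S CURRENCY, `r`-free** (`H` anisotropic hermitian; `(γ₀ − a)(γ₀ − b) = 0`,
`a ≠ b`; the singular Hasse principle `hHasse` for ★ `singularObs` and the κ-weight `W` as BINDERS; `mG v` ∕ `mGi` admissible on the classes corresponding to
`(γ₀)_v` ∕ `γ₀ ⊗ 1`; `mG` normalised off a finite set at `toAdelic γ₀` and at every matching adèle; `T` an `IsTest` pure tensor):
`Φ^st_{ofLocal mG mGi}(𝒪_st(γ₀), T.eval) = (1∕2) · (adelicStableOrbitalSum 𝒞′_𝐀(γ₀) (ofLocalAdelic mG mGi) T.eval + adelicKappaOrbitalSum 𝒞′_𝐀(γ₀) W (ofLocalAdelic mG mGi) T.eval)`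
— §2 ∘ ★ (D1-s) FILE 3 `MatchingAdeleG₂.stableOrbitalSum_map_toAdelic_ofLocalAdelic_eq_half_of_singularObs`.  This is the binder `hD1` of the line's
`lawT1b_singular_of_pieces` token for token. [cite: Rogawski1990, §5.4 (5.4.1)–(5.4.3) pp. 72–73; §3.8 Prop. 3.8.1 (d) p. 27; §14.5 pp. 238–239] [cite: Kottwitz1986, §9] -/
theorem adelicStableOrbitalIntegral_ofLocal_stableClassOf_eq_half_of_singularObs
    (hH : (H.map (cmConjRingHom L))ᵀ = H) (hanis : ∀ x : Fin 3 → L, hermForm (cmConjRingHom L) H x x = 0 → x = 0)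
    (hab : a ≠ b)
    (hγ₀ : ((((γ₀ : unitaryGroup (cmConjRingHom L) H).val : GL (Fin 3) L) : Matrix (Fin 3) (Fin 3) L) - a • (1 : Matrix (Fin 3) (Fin 3) L)) *
      ((((γ₀ : unitaryGroup (cmConjRingHom L) H).val : GL (Fin 3) L) : Matrix (Fin 3) (Fin 3) L) - b • (1 : Matrix (Fin 3) (Fin 3) L)) = 0)
    (hHasse : ∀ p : MatchingAdeleG₂ L H H γ₀, p.singularObs hab hγ₀ = 0 ↔ ∃ γ : (UnitaryGroup.cmDatum L 3 H).Rational, p.IsRationalOver γ)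
    (W : ConjClasses (UnitaryGroup.cmDatum L 3 H).Adelic → ℂ)
    (hW : ∀ q : MatchingAdeleG₂ L H H γ₀, W (ConjClasses.mk q.adele) = if q.singularObs hab hγ₀ = 0 then 1 else -1)
    (mG : ∀ v : HeightOneSpectrum (𝓞 ↥(maximalRealSubfield L)), OrbitalMeasureFamily ((UnitaryGroup.cmDatum L 3 H).Local v))
    (mGi : OrbitalMeasureFamily (UnitaryGroup.arch (↥(maximalRealSubfield L)) L (IsCMField.complexConj L) 3 H))
    (hadm : ∀ v, (mG v).IsAdmissibleOn fun x : (UnitaryGroup.cmDatum L 3 H).Local v =>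
      Corresponds (UnitaryGroup.conjLocal L (IsCMField.complexConj L) v)
        ((UnitaryGroup.adelicForm L 3 H).map (UnitaryGroup.adeleToLocal L v))
        ((UnitaryGroup.adelicForm L 3 H).map (UnitaryGroup.adeleToLocal L v))
        ((UnitaryGroup.cmDatum L 3 H).toLocal v ((UnitaryGroup.cmDatum L 3 H).toAdelic γ₀)) x)
    (hadmA : mGi.IsAdmissibleOn fun a : UnitaryGroup.arch (↥(maximalRealSubfield L)) L (IsCMField.complexConj L) 3 H =>
      Corresponds (UnitaryGroup.conjMixed (↥(maximalRealSubfield L)) L (IsCMField.complexConj L)) (UnitaryGroup.archFormOf L 3 H)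
        (UnitaryGroup.archFormOf L 3 H) (cmRationalToArch L 3 H γ₀) a)
    (hnormγ : ∃ S₀ : Finset (HeightOneSpectrum (𝓞 ↥(maximalRealSubfield L))),
      UnitaryGroup.IsNormalisedOff L 3 H mG ((UnitaryGroup.cmDatum L 3 H).toAdelic γ₀) S₀)
    (hnorm : ∀ p : MatchingAdeleG₂ L H H γ₀, ∃ S₀ : Finset (HeightOneSpectrum (𝓞 ↥(maximalRealSubfield L))),
      UnitaryGroup.IsNormalisedOff L 3 H mG p.adele S₀)
    (T : UnitaryGroup.PureTensor L 3 H) (hT : T.IsTest) :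
    UnitaryGroup.adelicStableOrbitalIntegral L 3 H (UnitaryGroup.AdelicOrbitalMeasureFamily.ofLocal L 3 H mG mGi) T.eval (stableClassOf (cmConjRingHom L) H γ₀) =
      (1 / 2 : ℂ) * (adelicStableOrbitalSum (MatchingAdeleG₂.classes L H H γ₀) (UnitaryGroup.OrbitalMeasureFamily.ofLocalAdelic L 3 H mG mGi) T.eval +
        adelicKappaOrbitalSum (MatchingAdeleG₂.classes L H H γ₀) W (UnitaryGroup.OrbitalMeasureFamily.ofLocalAdelic L 3 H mG mGi) T.eval) := by
  rw [← stableOrbitalSum_ofLocalAdelic_map_toAdelic_eq_adelicStableOrbitalIntegral_ofLocal_of_mul_sub_eq_zero hH hanis hab hγ₀ mG mGi hadm hadmA hnorm T hT,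
    MatchingAdeleG₂.stableOrbitalSum_map_toAdelic_ofLocalAdelic_eq_half_of_singularObs hH hanis hab hγ₀ hHasse W hW mG mGi hadm hadmA hnormγ hnorm T hT, one_div]

/-- **The β-socket edition** (pin (viii‴-s) `PinMuAShapeSingular`: `μA c = ENNReal.ofReal r • ofLocal mG mGi c` on the rational classes of `𝒪_st(γ₀)`, `0 ≤ r` —
`r = α(𝒪_st)` for the line): `Φ^st_{μA}(𝒪_st(γ₀), T.eval) = r · (1∕2) · (adelicStableOrbitalSum 𝒞′_𝐀(γ₀) (ofLocalAdelic mG mGi) T.eval + adelicKappaOrbitalSum 𝒞′_𝐀(γ₀) W (ofLocalAdelic mG mGi) T.eval)`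
(★ (K-J) `adelicStableOrbitalIntegral_stableClassOf_eq_toReal_mul_of_forall_eq_smul` + the previous theorem) — the singular twin of ★ O11-1 §2
`adelicStableOrbitalIntegral_stableClassOf_eq_mul_inv_card_mul_of_equiv`. [cite: Rogawski1990, §14.5 pp. 237–239; §5.4 (5.4.1)–(5.4.3) pp. 72–73] [cite: Kottwitz1986, §9] -/
theorem adelicStableOrbitalIntegral_stableClassOf_eq_mul_half_of_singularObs
    (hH : (H.map (cmConjRingHom L))ᵀ = H) (hanis : ∀ x : Fin 3 → L, hermForm (cmConjRingHom L) H x x = 0 → x = 0)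
    (hab : a ≠ b)
    (hγ₀ : ((((γ₀ : unitaryGroup (cmConjRingHom L) H).val : GL (Fin 3) L) : Matrix (Fin 3) (Fin 3) L) - a • (1 : Matrix (Fin 3) (Fin 3) L)) *
      ((((γ₀ : unitaryGroup (cmConjRingHom L) H).val : GL (Fin 3) L) : Matrix (Fin 3) (Fin 3) L) - b • (1 : Matrix (Fin 3) (Fin 3) L)) = 0)
    (hHasse : ∀ p : MatchingAdeleG₂ L H H γ₀, p.singularObs hab hγ₀ = 0 ↔ ∃ γ : (UnitaryGroup.cmDatum L 3 H).Rational, p.IsRationalOver γ)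
    (W : ConjClasses (UnitaryGroup.cmDatum L 3 H).Adelic → ℂ)
    (hW : ∀ q : MatchingAdeleG₂ L H H γ₀, W (ConjClasses.mk q.adele) = if q.singularObs hab hγ₀ = 0 then 1 else -1)
    (mG : ∀ v : HeightOneSpectrum (𝓞 ↥(maximalRealSubfield L)), OrbitalMeasureFamily ((UnitaryGroup.cmDatum L 3 H).Local v))
    (mGi : OrbitalMeasureFamily (UnitaryGroup.arch (↥(maximalRealSubfield L)) L (IsCMField.complexConj L) 3 H))
    (hadm : ∀ v, (mG v).IsAdmissibleOn fun x : (UnitaryGroup.cmDatum L 3 H).Local v =>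
      Corresponds (UnitaryGroup.conjLocal L (IsCMField.complexConj L) v)
        ((UnitaryGroup.adelicForm L 3 H).map (UnitaryGroup.adeleToLocal L v))
        ((UnitaryGroup.adelicForm L 3 H).map (UnitaryGroup.adeleToLocal L v))
        ((UnitaryGroup.cmDatum L 3 H).toLocal v ((UnitaryGroup.cmDatum L 3 H).toAdelic γ₀)) x)
    (hadmA : mGi.IsAdmissibleOn fun a : UnitaryGroup.arch (↥(maximalRealSubfield L)) L (IsCMField.complexConj L) 3 H =>
      Corresponds (UnitaryGroup.conjMixed (↥(maximalRealSubfield L)) L (IsCMField.complexConj L)) (UnitaryGroup.archFormOf L 3 H)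
        (UnitaryGroup.archFormOf L 3 H) (cmRationalToArch L 3 H γ₀) a)
    (hnormγ : ∃ S₀ : Finset (HeightOneSpectrum (𝓞 ↥(maximalRealSubfield L))),
      UnitaryGroup.IsNormalisedOff L 3 H mG ((UnitaryGroup.cmDatum L 3 H).toAdelic γ₀) S₀)
    (hnorm : ∀ p : MatchingAdeleG₂ L H H γ₀, ∃ S₀ : Finset (HeightOneSpectrum (𝓞 ↥(maximalRealSubfield L))),
      UnitaryGroup.IsNormalisedOff L 3 H mG p.adele S₀)
    (μA : UnitaryGroup.AdelicOrbitalMeasureFamily L 3 H) {r : ℝ} (hr : 0 ≤ r)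
    (hμA : ∀ c ∈ conjClassesIn (cmConjRingHom L) H γ₀, μA c = ENNReal.ofReal r • UnitaryGroup.AdelicOrbitalMeasureFamily.ofLocal L 3 H mG mGi c)
    (T : UnitaryGroup.PureTensor L 3 H) (hT : T.IsTest) :
    UnitaryGroup.adelicStableOrbitalIntegral L 3 H μA T.eval (stableClassOf (cmConjRingHom L) H γ₀) =
      (r : ℂ) * (1 / 2 : ℂ) * (adelicStableOrbitalSum (MatchingAdeleG₂.classes L H H γ₀) (UnitaryGroup.OrbitalMeasureFamily.ofLocalAdelic L 3 H mG mGi) T.eval +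
        adelicKappaOrbitalSum (MatchingAdeleG₂.classes L H H γ₀) W (UnitaryGroup.OrbitalMeasureFamily.ofLocalAdelic L 3 H mG mGi) T.eval) := by
  rw [UnitaryGroup.adelicStableOrbitalIntegral_stableClassOf_eq_toReal_mul_of_forall_eq_smul L 3 H μA _ (ENNReal.ofReal r) hμA,
    adelicStableOrbitalIntegral_ofLocal_stableClassOf_eq_half_of_singularObs hH hanis hab hγ₀ hHasse W hW mG mGi hadm hadmA hnormγ hnorm T hT,
    ENNReal.toReal_ofReal hr, mul_assoc]

end Bridge

/-! ## §4 (ED. 2) `hD1` with the normalisation binder at the matching adèles DISCHARGED — only the base-point pin `hnormγ` remains -/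

section Pin

variable {L : Type} [Field L] [NumberField L] [IsCMField L] {H : Matrix (Fin 3) (Fin 3) L} {γ₀ : (UnitaryGroup.cmDatum L 3 H).Rational} {a b : L}
  [∀ g : (UnitaryGroup.cmDatum L 3 H).Adelic,
    MeasurableSpace ((UnitaryGroup.cmDatum L 3 H).Adelic ⧸ Subgroup.centralizer ({g} : Set (UnitaryGroup.cmDatum L 3 H).Adelic))]
  [∀ g : (UnitaryGroup.cmDatum L 3 H).Adelic,
    BorelSpace ((UnitaryGroup.cmDatum L 3 H).Adelic ⧸ Subgroup.centralizer ({g} : Set (UnitaryGroup.cmDatum L 3 H).Adelic))]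
  [∀ (v : HeightOneSpectrum (𝓞 ↥(maximalRealSubfield L))) (x : (UnitaryGroup.cmDatum L 3 H).Local v),
    MeasurableSpace ((UnitaryGroup.cmDatum L 3 H).Local v ⧸ Subgroup.centralizer ({x} : Set ((UnitaryGroup.cmDatum L 3 H).Local v)))]
  [∀ (v : HeightOneSpectrum (𝓞 ↥(maximalRealSubfield L))) (x : (UnitaryGroup.cmDatum L 3 H).Local v),
    BorelSpace ((UnitaryGroup.cmDatum L 3 H).Local v ⧸ Subgroup.centralizer ({x} : Set ((UnitaryGroup.cmDatum L 3 H).Local v)))]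
  [∀ a : UnitaryGroup.arch (↥(maximalRealSubfield L)) L (IsCMField.complexConj L) 3 H,
    MeasurableSpace (UnitaryGroup.arch (↥(maximalRealSubfield L)) L (IsCMField.complexConj L) 3 H ⧸
      Subgroup.centralizer ({a} : Set (UnitaryGroup.arch (↥(maximalRealSubfield L)) L (IsCMField.complexConj L) 3 H)))]
  [∀ a : UnitaryGroup.arch (↥(maximalRealSubfield L)) L (IsCMField.complexConj L) 3 H,
    BorelSpace (UnitaryGroup.arch (↥(maximalRealSubfield L)) L (IsCMField.complexConj L) 3 H ⧸
      Subgroup.centralizer ({a} : Set (UnitaryGroup.arch (↥(maximalRealSubfield L)) L (IsCMField.complexConj L) 3 H)))]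

/-- **`hD1` WITH THE NORMALISATION AT THE MATCHING ADÈLES DISCHARGED** (ED. 2): the binder `hnorm : ∀ p : MatchingAdeleG₂ L H H γ₀, ∃ S₀, IsNormalisedOff mG p.adele S₀`
of §3 is a THEOREM of the base-point pin `hnormγ : ∃ S₀, IsNormalisedOff mG (toAdelic γ₀) S₀` and class-local admissibility — ★ (NORM-s)
`MatchingAdeleG₂.forall_exists_isNormalisedOff_of_mul_sub_eq_zero` (F0P3a-p08 (g6): a.e. `K_v`-conjugacy ★ K6-α + `atPoint` at `K_v`-conjugate points) at `H₁ = H₂ = H`,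
`γ := γ₀`.  So the `J`-side input of T1b at a split semisimple class reads, with ONLY the kit's pins as binders (`hHasse` = (h5), `W`∕`hW` = `PinSingularKappaHalf`'s weight,
admissibility (ix-s), base-point normalisation, `IsTest`):
`Φ^st_{ofLocal mG mGi}(𝒪_st(γ₀), T.eval) = (1∕2) · (adelicStableOrbitalSum 𝒞′_𝐀(γ₀) (ofLocalAdelic mG mGi) T.eval + adelicKappaOrbitalSum 𝒞′_𝐀(γ₀) W (ofLocalAdelic mG mGi) T.eval)`.
[cite: Rogawski1990, §5.4 (5.4.1)–(5.4.3) pp. 72–73; §3.8 Prop. 3.8.1 (d) p. 27; §4.3 p. 44; §14.5 pp. 238–239] [cite: Kottwitz1986, Prop. 7.1, §9] -/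
theorem adelicStableOrbitalIntegral_ofLocal_stableClassOf_eq_half_of_singularObs_of_isNormalisedOff
    (hH : (H.map (cmConjRingHom L))ᵀ = H) (hanis : ∀ x : Fin 3 → L, hermForm (cmConjRingHom L) H x x = 0 → x = 0)
    (hab : a ≠ b)
    (hγ₀ : ((((γ₀ : unitaryGroup (cmConjRingHom L) H).val : GL (Fin 3) L) : Matrix (Fin 3) (Fin 3) L) - a • (1 : Matrix (Fin 3) (Fin 3) L)) *
      ((((γ₀ : unitaryGroup (cmConjRingHom L) H).val : GL (Fin 3) L) : Matrix (Fin 3) (Fin 3) L) - b • (1 : Matrix (Fin 3) (Fin 3) L)) = 0)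
    (hHasse : ∀ p : MatchingAdeleG₂ L H H γ₀, p.singularObs hab hγ₀ = 0 ↔ ∃ γ : (UnitaryGroup.cmDatum L 3 H).Rational, p.IsRationalOver γ)
    (W : ConjClasses (UnitaryGroup.cmDatum L 3 H).Adelic → ℂ)
    (hW : ∀ q : MatchingAdeleG₂ L H H γ₀, W (ConjClasses.mk q.adele) = if q.singularObs hab hγ₀ = 0 then 1 else -1)
    (mG : ∀ v : HeightOneSpectrum (𝓞 ↥(maximalRealSubfield L)), OrbitalMeasureFamily ((UnitaryGroup.cmDatum L 3 H).Local v))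
    (mGi : OrbitalMeasureFamily (UnitaryGroup.arch (↥(maximalRealSubfield L)) L (IsCMField.complexConj L) 3 H))
    (hadm : ∀ v, (mG v).IsAdmissibleOn fun x : (UnitaryGroup.cmDatum L 3 H).Local v =>
      Corresponds (UnitaryGroup.conjLocal L (IsCMField.complexConj L) v)
        ((UnitaryGroup.adelicForm L 3 H).map (UnitaryGroup.adeleToLocal L v))
        ((UnitaryGroup.adelicForm L 3 H).map (UnitaryGroup.adeleToLocal L v))
        ((UnitaryGroup.cmDatum L 3 H).toLocal v ((UnitaryGroup.cmDatum L 3 H).toAdelic γ₀)) x)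
    (hadmA : mGi.IsAdmissibleOn fun a : UnitaryGroup.arch (↥(maximalRealSubfield L)) L (IsCMField.complexConj L) 3 H =>
      Corresponds (UnitaryGroup.conjMixed (↥(maximalRealSubfield L)) L (IsCMField.complexConj L)) (UnitaryGroup.archFormOf L 3 H)
        (UnitaryGroup.archFormOf L 3 H) (cmRationalToArch L 3 H γ₀) a)
    (hnormγ : ∃ S₀ : Finset (HeightOneSpectrum (𝓞 ↥(maximalRealSubfield L))),
      UnitaryGroup.IsNormalisedOff L 3 H mG ((UnitaryGroup.cmDatum L 3 H).toAdelic γ₀) S₀)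
    (T : UnitaryGroup.PureTensor L 3 H) (hT : T.IsTest) :
    UnitaryGroup.adelicStableOrbitalIntegral L 3 H (UnitaryGroup.AdelicOrbitalMeasureFamily.ofLocal L 3 H mG mGi) T.eval (stableClassOf (cmConjRingHom L) H γ₀) =
      (1 / 2 : ℂ) * (adelicStableOrbitalSum (MatchingAdeleG₂.classes L H H γ₀) (UnitaryGroup.OrbitalMeasureFamily.ofLocalAdelic L 3 H mG mGi) T.eval +
        adelicKappaOrbitalSum (MatchingAdeleG₂.classes L H H γ₀) W (UnitaryGroup.OrbitalMeasureFamily.ofLocalAdelic L 3 H mG mGi) T.eval) :=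
  adelicStableOrbitalIntegral_ofLocal_stableClassOf_eq_half_of_singularObs hH hanis hab hγ₀ hHasse W hW mG mGi hadm hadmA hnormγ
    (MatchingAdeleG₂.forall_exists_isNormalisedOff_of_mul_sub_eq_zero hH (Godement.det_ne_zero_of_anisotropic L H hanis) (γ := γ₀) (IsConj.refl _) hab hγ₀
      mG hadm hnormγ) T hT

end Pin

/-! ## §5 (ED. 3) `hD1` with the singular Hasse principle DISCHARGED — only non-centrality of `γ₀` remains -/

section Hasse

variable {L : Type} [Field L] [NumberField L] [IsCMField L] {H : Matrix (Fin 3) (Fin 3) L} {γ₀ : (UnitaryGroup.cmDatum L 3 H).Rational} {a b : L}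
  [∀ g : (UnitaryGroup.cmDatum L 3 H).Adelic,
    MeasurableSpace ((UnitaryGroup.cmDatum L 3 H).Adelic ⧸ Subgroup.centralizer ({g} : Set (UnitaryGroup.cmDatum L 3 H).Adelic))]
  [∀ g : (UnitaryGroup.cmDatum L 3 H).Adelic,
    BorelSpace ((UnitaryGroup.cmDatum L 3 H).Adelic ⧸ Subgroup.centralizer ({g} : Set (UnitaryGroup.cmDatum L 3 H).Adelic))]
  [∀ (v : HeightOneSpectrum (𝓞 ↥(maximalRealSubfield L))) (x : (UnitaryGroup.cmDatum L 3 H).Local v),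
    MeasurableSpace ((UnitaryGroup.cmDatum L 3 H).Local v ⧸ Subgroup.centralizer ({x} : Set ((UnitaryGroup.cmDatum L 3 H).Local v)))]
  [∀ (v : HeightOneSpectrum (𝓞 ↥(maximalRealSubfield L))) (x : (UnitaryGroup.cmDatum L 3 H).Local v),
    BorelSpace ((UnitaryGroup.cmDatum L 3 H).Local v ⧸ Subgroup.centralizer ({x} : Set ((UnitaryGroup.cmDatum L 3 H).Local v)))]
  [∀ a : UnitaryGroup.arch (↥(maximalRealSubfield L)) L (IsCMField.complexConj L) 3 H,
    MeasurableSpace (UnitaryGroup.arch (↥(maximalRealSubfield L)) L (IsCMField.complexConj L) 3 H ⧸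
      Subgroup.centralizer ({a} : Set (UnitaryGroup.arch (↥(maximalRealSubfield L)) L (IsCMField.complexConj L) 3 H)))]
  [∀ a : UnitaryGroup.arch (↥(maximalRealSubfield L)) L (IsCMField.complexConj L) 3 H,
    BorelSpace (UnitaryGroup.arch (↥(maximalRealSubfield L)) L (IsCMField.complexConj L) 3 H ⧸
      Subgroup.centralizer ({a} : Set (UnitaryGroup.arch (↥(maximalRealSubfield L)) L (IsCMField.complexConj L) 3 H)))]

/-- **`hD1` WITH THE SINGULAR HASSE PRINCIPLE DISCHARGED** (ED. 3): the binder `hHasse : ∀ p, obs_s(p) = 0 ↔ ∃ γ, p.IsRationalOver γ` of §3∕§4 is a THEOREM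
for `H` anisotropic and `γ₀` NON-CENTRAL (`γ₀ ≠ a·1`, `γ₀ ≠ b·1`) — ★ (h5) `MatchingAdeleG₂.singularObsHasse_of_ne_smul_one` (Kottwitz's criterion Prop. 3.3.1 at a
singular non-central semisimple class, the trunk's assembly `SingularObsHasseRealisation` ED. 2, F0P5a-p03 (g5)).  So the `J`-side input of T1b at a split semisimple
NON-CENTRAL class reads, with ONLY the kit's pins as binders (`W`∕`hW` = the κ-weight, admissibility (ix-s), base-point normalisation, `IsTest`):
`Φ^st_{ofLocal mG mGi}(𝒪_st(γ₀), T.eval) = (1∕2) · (adelicStableOrbitalSum 𝒞′_𝐀(γ₀) (ofLocalAdelic mG mGi) T.eval + adelicKappaOrbitalSum 𝒞′_𝐀(γ₀) W (ofLocalAdelic mG mGi) T.eval)`.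
[cite: Rogawski1990, §3.3 Prop. 3.3.1 p. 22; §3.8 Prop. 3.8.1 (a)(d) pp. 27–30; §5.4 (5.4.1)–(5.4.3) pp. 72–73; §14.5 pp. 238–239] [cite: Kottwitz1986, §7 Prop. 7.1, §9] -/
theorem adelicStableOrbitalIntegral_ofLocal_stableClassOf_eq_half_of_singularObs_of_ne_smul_one
    (hH : (H.map (cmConjRingHom L))ᵀ = H) (hanis : ∀ x : Fin 3 → L, hermForm (cmConjRingHom L) H x x = 0 → x = 0)
    (hab : a ≠ b)
    (hγ₀ : ((((γ₀ : unitaryGroup (cmConjRingHom L) H).val : GL (Fin 3) L) : Matrix (Fin 3) (Fin 3) L) - a • (1 : Matrix (Fin 3) (Fin 3) L)) *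
      ((((γ₀ : unitaryGroup (cmConjRingHom L) H).val : GL (Fin 3) L) : Matrix (Fin 3) (Fin 3) L) - b • (1 : Matrix (Fin 3) (Fin 3) L)) = 0)
    (hna : (((γ₀ : unitaryGroup (cmConjRingHom L) H).val : GL (Fin 3) L) : Matrix (Fin 3) (Fin 3) L) ≠ a • (1 : Matrix (Fin 3) (Fin 3) L))
    (hnb : (((γ₀ : unitaryGroup (cmConjRingHom L) H).val : GL (Fin 3) L) : Matrix (Fin 3) (Fin 3) L) ≠ b • (1 : Matrix (Fin 3) (Fin 3) L))
    (W : ConjClasses (UnitaryGroup.cmDatum L 3 H).Adelic → ℂ)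
    (hW : ∀ q : MatchingAdeleG₂ L H H γ₀, W (ConjClasses.mk q.adele) = if q.singularObs hab hγ₀ = 0 then 1 else -1)
    (mG : ∀ v : HeightOneSpectrum (𝓞 ↥(maximalRealSubfield L)), OrbitalMeasureFamily ((UnitaryGroup.cmDatum L 3 H).Local v))
    (mGi : OrbitalMeasureFamily (UnitaryGroup.arch (↥(maximalRealSubfield L)) L (IsCMField.complexConj L) 3 H))
    (hadm : ∀ v, (mG v).IsAdmissibleOn fun x : (UnitaryGroup.cmDatum L 3 H).Local v =>
      Corresponds (UnitaryGroup.conjLocal L (IsCMField.complexConj L) v)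
        ((UnitaryGroup.adelicForm L 3 H).map (UnitaryGroup.adeleToLocal L v))
        ((UnitaryGroup.adelicForm L 3 H).map (UnitaryGroup.adeleToLocal L v))
        ((UnitaryGroup.cmDatum L 3 H).toLocal v ((UnitaryGroup.cmDatum L 3 H).toAdelic γ₀)) x)
    (hadmA : mGi.IsAdmissibleOn fun a : UnitaryGroup.arch (↥(maximalRealSubfield L)) L (IsCMField.complexConj L) 3 H =>
      Corresponds (UnitaryGroup.conjMixed (↥(maximalRealSubfield L)) L (IsCMField.complexConj L)) (UnitaryGroup.archFormOf L 3 H)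
        (UnitaryGroup.archFormOf L 3 H) (cmRationalToArch L 3 H γ₀) a)
    (hnormγ : ∃ S₀ : Finset (HeightOneSpectrum (𝓞 ↥(maximalRealSubfield L))),
      UnitaryGroup.IsNormalisedOff L 3 H mG ((UnitaryGroup.cmDatum L 3 H).toAdelic γ₀) S₀)
    (T : UnitaryGroup.PureTensor L 3 H) (hT : T.IsTest) :
    UnitaryGroup.adelicStableOrbitalIntegral L 3 H (UnitaryGroup.AdelicOrbitalMeasureFamily.ofLocal L 3 H mG mGi) T.eval (stableClassOf (cmConjRingHom L) H γ₀) =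
      (1 / 2 : ℂ) * (adelicStableOrbitalSum (MatchingAdeleG₂.classes L H H γ₀) (UnitaryGroup.OrbitalMeasureFamily.ofLocalAdelic L 3 H mG mGi) T.eval +
        adelicKappaOrbitalSum (MatchingAdeleG₂.classes L H H γ₀) W (UnitaryGroup.OrbitalMeasureFamily.ofLocalAdelic L 3 H mG mGi) T.eval) :=
  adelicStableOrbitalIntegral_ofLocal_stableClassOf_eq_half_of_singularObs_of_isNormalisedOff hH hanis hab hγ₀
    (MatchingAdeleG₂.singularObsHasse_of_ne_smul_one hH (Godement.det_ne_zero_of_anisotropic L H hanis) hanis hab hγ₀ hna hnb) W hW mG mGi hadm hadmA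
    hnormγ T hT

/-- **`hD1` IN THE LETTERS OF ★ `singular_semisimple_dichotomy`** (`charpoly γ₀ = (X − a)²(X − b)`, `a ≠ b`; `(γ₀ − a)(γ₀ − b) = 0` kept as the binder the
obstruction `singularObs hab hγ₀` is indexed by): non-centrality follows from the characteristic polynomial (★ `ne_smul_one_and_ne_smul_one_of_charpoly_eq`),
then the previous theorem. [cite: Rogawski1990, §3.3 Prop. 3.3.1 p. 22; §5.4 (5.4.1)–(5.4.3) pp. 72–73; §14.5 pp. 238–239] [cite: Kottwitz1986, §9] -/
theorem adelicStableOrbitalIntegral_ofLocal_stableClassOf_eq_half_of_singularObs_of_charpoly_eq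
    (hH : (H.map (cmConjRingHom L))ᵀ = H) (hanis : ∀ x : Fin 3 → L, hermForm (cmConjRingHom L) H x x = 0 → x = 0)
    (hab : a ≠ b)
    (hγ₀ : ((((γ₀ : unitaryGroup (cmConjRingHom L) H).val : GL (Fin 3) L) : Matrix (Fin 3) (Fin 3) L) - a • (1 : Matrix (Fin 3) (Fin 3) L)) *
      ((((γ₀ : unitaryGroup (cmConjRingHom L) H).val : GL (Fin 3) L) : Matrix (Fin 3) (Fin 3) L) - b • (1 : Matrix (Fin 3) (Fin 3) L)) = 0)
    (hchar : (((γ₀ : unitaryGroup (cmConjRingHom L) H).val : GL (Fin 3) L) : Matrix (Fin 3) (Fin 3) L).charpoly =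
      (Polynomial.X - Polynomial.C a) ^ 2 * (Polynomial.X - Polynomial.C b))
    (W : ConjClasses (UnitaryGroup.cmDatum L 3 H).Adelic → ℂ)
    (hW : ∀ q : MatchingAdeleG₂ L H H γ₀, W (ConjClasses.mk q.adele) = if q.singularObs hab hγ₀ = 0 then 1 else -1)
    (mG : ∀ v : HeightOneSpectrum (𝓞 ↥(maximalRealSubfield L)), OrbitalMeasureFamily ((UnitaryGroup.cmDatum L 3 H).Local v))
    (mGi : OrbitalMeasureFamily (UnitaryGroup.arch (↥(maximalRealSubfield L)) L (IsCMField.complexConj L) 3 H))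
    (hadm : ∀ v, (mG v).IsAdmissibleOn fun x : (UnitaryGroup.cmDatum L 3 H).Local v =>
      Corresponds (UnitaryGroup.conjLocal L (IsCMField.complexConj L) v)
        ((UnitaryGroup.adelicForm L 3 H).map (UnitaryGroup.adeleToLocal L v))
        ((UnitaryGroup.adelicForm L 3 H).map (UnitaryGroup.adeleToLocal L v))
        ((UnitaryGroup.cmDatum L 3 H).toLocal v ((UnitaryGroup.cmDatum L 3 H).toAdelic γ₀)) x)
    (hadmA : mGi.IsAdmissibleOn fun a : UnitaryGroup.arch (↥(maximalRealSubfield L)) L (IsCMField.complexConj L) 3 H =>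
      Corresponds (UnitaryGroup.conjMixed (↥(maximalRealSubfield L)) L (IsCMField.complexConj L)) (UnitaryGroup.archFormOf L 3 H)
        (UnitaryGroup.archFormOf L 3 H) (cmRationalToArch L 3 H γ₀) a)
    (hnormγ : ∃ S₀ : Finset (HeightOneSpectrum (𝓞 ↥(maximalRealSubfield L))),
      UnitaryGroup.IsNormalisedOff L 3 H mG ((UnitaryGroup.cmDatum L 3 H).toAdelic γ₀) S₀)
    (T : UnitaryGroup.PureTensor L 3 H) (hT : T.IsTest) :
    UnitaryGroup.adelicStableOrbitalIntegral L 3 H (UnitaryGroup.AdelicOrbitalMeasureFamily.ofLocal L 3 H mG mGi) T.eval (stableClassOf (cmConjRingHom L) H γ₀) =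
      (1 / 2 : ℂ) * (adelicStableOrbitalSum (MatchingAdeleG₂.classes L H H γ₀) (UnitaryGroup.OrbitalMeasureFamily.ofLocalAdelic L 3 H mG mGi) T.eval +
        adelicKappaOrbitalSum (MatchingAdeleG₂.classes L H H γ₀) W (UnitaryGroup.OrbitalMeasureFamily.ofLocalAdelic L 3 H mG mGi) T.eval) :=
  adelicStableOrbitalIntegral_ofLocal_stableClassOf_eq_half_of_singularObs_of_ne_smul_one hH hanis hab hγ₀
    (ne_smul_one_and_ne_smul_one_of_charpoly_eq hab hchar).1 (ne_smul_one_and_ne_smul_one_of_charpoly_eq hab hchar).2 W hW mG mGi hadm hadmA hnormγ T hT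

end Hasse

end Literature.NumberTheory.Rogawski1990

end
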